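import Summits.QuantumFields.YangMills.Theorems.UnitScaleTiltProp8ChartDoubleBarOneStep
import Literature.MathematicalPhysics.QuantumFieldTheory.Balaban1983to89.B7Prop1Explicit
import HarnessLib

/-!
# Route `UnitScaleTilt`, crux K1 «MinimiserStabilityRegPr» (stmt-QuantumFields-19200), leaf V2′ `stub_halvingStep` — pillar P3, RULING g26-№6 re-base (S3):
# **THE DOUBLE-BAR ONE STEP IN LOG COORDINATES** — `mlog(v(c₋)⁻¹·Ū(c)·v(c₊)) = |I|⁻¹Σ_{(n,σ,σ′)} X([x, x′]) + O(ℓ²r²)` for `S = exp X`, `‖X‖ ≤ r` on the two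
# blocks of `c`: the linear part of print's double-bar average at the flat background is the straight TUBE ([Balaban1985Averaging] (125)) with NO comb term, and the
# one-step remainder constant `C♭₁ = 40000ℓ²` is k-free («LOG coordinates in, LOG coordinates out» — the per-level input of the Prop. 5 kernel tower (148)–(155)).

Cell `ym3-torus` (HUMAN RULING D-0037, YM ladder rung R3 — YM₃ on T³ is a rung, not the Clay problem), width seat `ym-ust-19200-w4` gen 3, under OWNER RULING g26-№6 ∕
ACK 21 (frame of record = print's `exp[mean log]` (62); (S3) P3a engine re-read, LEAD ★w5-19200 g3; requested shape: ★w5-19936 g3 (S4′) «`V ↦ −i·mlog(dbarAvgU (expCfg 1 V) c)`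
… `‖… − L·bondAvg V c‖ ≤ C♭₁·(sup_{two blocks}‖V‖)²`»).  Companion of `…Prop8ChartDoubleBarOneStep` (the zeroth-order one step `‖v⁻¹Ūv − 1‖ ≤ L·s + 3800ℓ²s²`).
`--supports stmt-QuantumFields-19200 --as helper`; def-free, 0 sorry; nothing here is a claim about the stub, the crux, the rung or the mass gap.

WHAT IS PROVED (any complete normed `ℂ`-algebra `𝔸` with `‖1‖ = 1`; `ℓ = (d+2)L`):
* algebra: `walkSum_sub'`, `norm_three_factors_sub_lin_le`, `norm_triple_sub_models_le`; numerics: `log_step_numerics`; the abstract assembly `dbar_log_bookkeeping`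
  (letters `Vinv`, `Vval = 1 + a + O(θ²)`, `Ubar = 1 + Lin + O(θ²)`, `eW′ = 1 + a′ + O(θ²)`, the EXACT cancellation `Lin − a + a′ = B`, `‖mlog T − (T−1)‖ ≤ 4‖T−1‖²`);
* ★★ `norm_mlog_dbar_sub_segMean_le` — for `‖X(b)‖ ≤ r` and `S(b) = exp X(b)` on the two-block bonds of `c`, `200ℓr ≤ 1`:
  `‖mlog(dbarAvgU S c) − |I|⁻¹Σ_i X(segment_i)‖ ≤ 40000·ℓ²·r²` (`dbarAvgU S c = v(c₋)⁻¹·Ū(c)·v(c₊)`, ✓`…DoubleBarDefs`).  Mechanism: the engine's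
  `Ū = 1 + Lin(Z) + O(660ℓ²s²)` (`Prop8ChartOneStep.norm_emlAvgU_sub_one_sub_lin_le`, `Z = S − 1`, `s = 2r`), the frames `v = 1 + λ̄(Z) + O(586ℓ²s²)` (companion §1),
  the cancellation `Lin(Z) − λ̄_{c₋}(Z) + λ̄_{c₊}(Z) = |I|⁻¹Σ Z(segment)` (`BlockAveragingEMLLinearised.sum_idx_swap`: the second ordering is a dummy), `Z = X + O(r²)` on the
  `L` segment bonds, and `B7Prop1Explicit.norm_mlog_sub_le` for the final logarithm.  The consumer multiplies by `−I` and reads `|I|⁻¹Σ X(segment) = L·(bondAvg X)(c)`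
  off `linAvg_eq_bondAvg_sub_grad_combMean`'s proof (`walkEnd_emb_stairWord_eq_blockSite`, `walkSum_walk_replicate`, `sum_idx_of_fst`, `card_idx`).
HONEST SCOPE.  One averaging step, flat background; sizes only (the ℂ-differentiability half of the (S4′) input is the `ChartDiffLocal` template, not here); constants crude.

References: T. Bałaban, CMP **98** (1985) 17–51 [Balaban1985Averaging] ((62)–(63) p.28, (89) p.31, (121)–(125) p.36, (148)–(155) pp.40–42); CMP **95** (1984) 17–40
[Balaban1984PropagatorsI] ((1.11) p.19).
-/

noncomputable section

open scoped BigOperators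
open NormedSpace

namespace Summit.QuantumFields.YangMills.Theorems.Prop8ChartDoubleBar

open Literature.MathematicalPhysics.QuantumFieldTheory.Balaban1983to89
open T4Continuum BlockAveraging AveragingRT ExpMeanLog MatrixLog BlockAveragingEMLLinearised
open B10Eq27TorusAxialLog (holT)
open Summit.QuantumFields.YangMills.Theorems.Prop8Chart

variable {P : Params} {j : ℕ}
variable {𝔸 : Type*} [NormedRing 𝔸] [NormedAlgebra ℂ 𝔸] [CompleteSpace 𝔸] [NormOneClass 𝔸]

/-! ## §1 Algebra and numerics -/

omit [NormedAlgebra ℂ 𝔸] [CompleteSpace 𝔸] [NormOneClass 𝔸] in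
/-- `walkSum` is additive in the field (signed sums). [folklore] -/
theorem walkSum_sub' {V : Type*} [AddCommGroup V] (Y Y' : PBond P j → V) :
    ∀ γ : List (LStep P j), walkSum (Y - Y') γ = walkSum Y γ - walkSum Y' γ
  | [] => by simp [walkSum_nil]
  | st :: γ => by
    rw [walkSum_cons, walkSum_cons, walkSum_cons, walkSum_sub' Y Y' γ]
    simp only [Pi.sub_apply]
    split_ifs <;> abel

omit [NormedAlgebra ℂ 𝔸] [CompleteSpace 𝔸] [NormOneClass 𝔸] in
/-- Three near-`1` factors to first order: `‖(1 + x)(1 + y)(1 + z) − 1 − (x + y + z)‖ ≤ ‖x‖‖y‖ + ‖x‖‖z‖ + ‖y‖‖z‖ + ‖x‖‖y‖‖z‖`. [folklore] -/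
theorem norm_three_factors_sub_lin_le (x y z : 𝔸) :
    ‖(1 + x) * (1 + y) * (1 + z) - 1 - (x + y + z)‖ ≤ ‖x‖ * ‖y‖ + ‖x‖ * ‖z‖ + ‖y‖ * ‖z‖ + ‖x‖ * ‖y‖ * ‖z‖ := by
  have e : (1 + x) * (1 + y) * (1 + z) - 1 - (x + y + z) = x * y + x * z + y * z + x * y * z := by noncomm_ring
  rw [e]
  have h3 : ‖x * y * z‖ ≤ ‖x‖ * ‖y‖ * ‖z‖ := (norm_mul_le _ _).trans (mul_le_mul_of_nonneg_right (norm_mul_le _ _) (norm_nonneg _))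
  exact norm_add_le_of_le (norm_add_le_of_le (norm_add_le_of_le (norm_mul_le _ _) (norm_mul_le _ _)) (norm_mul_le _ _)) h3

omit [NormedAlgebra ℂ 𝔸] [CompleteSpace 𝔸] [NormOneClass 𝔸] in
/-- Replacing the three factors by their first-order models: `‖g·U·g′ − (1+x)(1+y)(1+z)‖` against the model errors. [folklore] -/
theorem norm_triple_sub_models_le {g U g' x y z : 𝔸} {e₁ e₂ e₃ nx ny : ℝ}
    (h1 : ‖g - (1 + x)‖ ≤ e₁) (h2 : ‖U - (1 + y)‖ ≤ e₂) (h3 : ‖g' - (1 + z)‖ ≤ e₃)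
    (hx : ‖1 + x‖ ≤ nx) (hy : ‖1 + y‖ ≤ ny) :
    ‖g * U * g' - (1 + x) * (1 + y) * (1 + z)‖ ≤ e₁ * ‖U‖ * ‖g'‖ + nx * e₂ * ‖g'‖ + nx * ny * e₃ := by
  have e : g * U * g' - (1 + x) * (1 + y) * (1 + z) =
      (g - (1 + x)) * U * g' + (1 + x) * (U - (1 + y)) * g' + (1 + x) * (1 + y) * (g' - (1 + z)) := by noncomm_ring
  rw [e]
  have t : ∀ a b c : 𝔸, ‖a * b * c‖ ≤ ‖a‖ * ‖b‖ * ‖c‖ := fun a b c =>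
    (norm_mul_le _ _).trans (mul_le_mul_of_nonneg_right (norm_mul_le _ _) (norm_nonneg _))
  have he₁ : 0 ≤ e₁ := (norm_nonneg _).trans h1
  have he₂ : 0 ≤ e₂ := (norm_nonneg _).trans h2
  have hnx : 0 ≤ nx := (norm_nonneg _).trans hx
  have hny : 0 ≤ ny := (norm_nonneg _).trans hy
  refine norm_add_le_of_le (norm_add_le_of_le ((t _ _ _).trans ?_) ((t _ _ _).trans ?_)) ((t _ _ _).trans ?_)
  · exact mul_le_mul (mul_le_mul_of_nonneg_right h1 (norm_nonneg _)) le_rfl (norm_nonneg _) (mul_nonneg he₁ (norm_nonneg _))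
  · exact mul_le_mul (mul_le_mul hx h2 (norm_nonneg _) hnx) le_rfl (norm_nonneg _) (mul_nonneg hnx he₂)
  · exact mul_le_mul (mul_le_mul hx hy (norm_nonneg _) hnx) h3 (norm_nonneg _) (mul_nonneg hnx hny)

/-- Real-number bookkeeping of the log-coordinate one step (`θ = ℓs ≤ 1/100`). [folklore] -/
theorem log_step_numerics {θ nU nW na nL na' : ℝ} (hθ0 : 0 ≤ θ) (hθ : θ ≤ 1 / 100)
    (hnW0 : 0 ≤ nW) (hnL0 : 0 ≤ nL) (hna'0 : 0 ≤ na')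
    (hnU : nU ≤ 1 + 17 * θ) (hnW : nW ≤ 1 + 16 * θ) (hna : na ≤ θ) (hnL : nL ≤ 24 * θ) (hna' : na' ≤ θ) :
    1098 * θ ^ 2 * nU * nW + (1 + θ) * (660 * θ ^ 2) * nW + (1 + θ) * (1 + 24 * θ) * (586 * θ ^ 2) +
      (na * nL + na * na' + nL * na' + na * nL * na') ≤ 3200 * θ ^ 2 := by
  have hθ2 : 0 ≤ θ ^ 2 := sq_nonneg θ
  have h1 : nU * nW ≤ 7 / 5 := by nlinarith [mul_le_mul hnU hnW hnW0 (by linarith)]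
  have h2 : (1 + θ) * nW ≤ 6 / 5 := by nlinarith
  have h3 : (1 + θ) * (1 + 24 * θ) ≤ 13 / 10 := by nlinarith
  have t1 : 1098 * θ ^ 2 * nU * nW ≤ 1098 * θ ^ 2 * (7 / 5) := by
    have : 1098 * θ ^ 2 * nU * nW = 1098 * θ ^ 2 * (nU * nW) := by ring
    rw [this]; exact mul_le_mul_of_nonneg_left h1 (by positivity)
  have t2 : (1 + θ) * (660 * θ ^ 2) * nW ≤ 660 * θ ^ 2 * (6 / 5) := by
    have : (1 + θ) * (660 * θ ^ 2) * nW = 660 * θ ^ 2 * ((1 + θ) * nW) := by ring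
    rw [this]; exact mul_le_mul_of_nonneg_left h2 (by positivity)
  have t3 : (1 + θ) * (1 + 24 * θ) * (586 * θ ^ 2) ≤ (13 / 10) * (586 * θ ^ 2) := mul_le_mul_of_nonneg_right h3 (by positivity)
  have t4 : na * nL ≤ θ * (24 * θ) := mul_le_mul hna hnL hnL0 hθ0
  have t5 : na * na' ≤ θ * θ := mul_le_mul hna hna' hna'0 hθ0
  have t6 : nL * na' ≤ (24 * θ) * θ := mul_le_mul hnL hna' hna'0 (by positivity)
  have t7 : na * nL * na' ≤ θ * (24 * θ) * θ := mul_le_mul t4 hna' hna'0 (by positivity)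
  nlinarith

/-! ## §2 The abstract assembly -/

/-- **THE LOG-COORDINATE ONE STEP, ABSTRACTED** over the letters: inverse frame `Vinv` (`Vinv·Vval = 1`), frame values `Vval = 1 + a + O(586θ²)`, `eW′ = 1 + a′ + O(586θ²)`,
average `Ubar = 1 + Lin + O(660θ²)` (`Vinv·Vval = 1`), the EXACT cancellation `Lin − a + a′ = B`, the segment sums `‖B − BX‖ ≤ ε_B`, and the zeroth-order size `‖Vinv·Ubar·eW′ − 1‖ ≤ 39θ`
(`θ ≤ 1/100`) give `‖mlog(Vinv·Ubar·eW′) − BX‖ ≤ 9284θ² + ε_B`. [cite: Balaban1985Averaging, (121)-(125) p.36] -/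
theorem dbar_log_bookkeeping {Vinv Vval Ubar eW' a a' Lin B BX : 𝔸} {θ εB : ℝ} (hθ0 : 0 ≤ θ) (hθ : θ ≤ 1 / 100)
    (hinv : Vinv * Vval = 1)
    (hVa : ‖Vval - 1 - a‖ ≤ 586 * θ ^ 2) (hV1 : ‖Vval - 1‖ ≤ 16 * θ)
    (hUlin : ‖Ubar - 1 - Lin‖ ≤ 660 * θ ^ 2) (hU1 : ‖Ubar - 1‖ ≤ 17 * θ)
    (hW'a : ‖eW' - 1 - a'‖ ≤ 586 * θ ^ 2) (hW'1 : ‖eW' - 1‖ ≤ 16 * θ)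
    (ha1 : ‖a‖ ≤ θ) (ha'1 : ‖a'‖ ≤ θ) (hcancel : Lin - a + a' = B) (hBBX : ‖B - BX‖ ≤ εB)
    (hT1 : ‖Vinv * Ubar * eW' - 1‖ ≤ 39 * θ) :
    ‖mlog (Vinv * Ubar * eW') - BX‖ ≤ 9284 * θ ^ 2 + εB := by
  -- the inverse frame to second order: `Vinv = 1 − a + O(1098θ²)` (`Vinv − 1 + (Vval − 1) = (Vinv − 1)(1 − Vval)`)
  have hVinv1 : ‖Vinv - 1‖ ≤ 2 * (16 * θ) := by
    have e : Vinv - 1 = Vinv * (1 - Vval) := by rw [mul_sub, mul_one, hinv]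
    have h1 : ‖Vinv - 1‖ ≤ (‖Vinv - 1‖ + 1) * (16 * θ) := by
      calc ‖Vinv - 1‖ = ‖Vinv * (1 - Vval)‖ := by rw [← e]
        _ ≤ ‖Vinv‖ * ‖1 - Vval‖ := norm_mul_le _ _
        _ ≤ (‖Vinv - 1‖ + ‖(1 : 𝔸)‖) * (16 * θ) := by
            refine mul_le_mul ?_ (by rw [norm_sub_rev]; exact hV1) (norm_nonneg _) (by positivity)
            calc ‖Vinv‖ = ‖(Vinv - 1) + 1‖ := by rw [sub_add_cancel]
              _ ≤ ‖Vinv - 1‖ + ‖(1 : 𝔸)‖ := norm_add_le _ _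
        _ ≤ (‖Vinv - 1‖ + 1) * (16 * θ) := by
            refine mul_le_mul_of_nonneg_right (add_le_add le_rfl norm_one.le) (by positivity)
    nlinarith [norm_nonneg (Vinv - 1)]
  have hVinv_a : ‖Vinv - (1 + (-a))‖ ≤ 1098 * θ ^ 2 := by
    have e1 : Vinv - 1 + (Vval - 1) = (Vinv - 1) * (1 - Vval) := by
      have : Vinv * Vval = 1 := hinv
      noncomm_ring [this]
    have h1 : ‖Vinv - 1 + (Vval - 1)‖ ≤ 2 * (16 * θ) ^ 2 := by
      rw [e1]
      calc _ ≤ ‖Vinv - 1‖ * ‖1 - Vval‖ := norm_mul_le _ _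
        _ ≤ (2 * (16 * θ)) * (16 * θ) := mul_le_mul hVinv1 (by rw [norm_sub_rev]; exact hV1) (norm_nonneg _) (by positivity)
        _ = 2 * (16 * θ) ^ 2 := by ring
    have e : Vinv - (1 + (-a)) = (Vinv - 1 + (Vval - 1)) - ((Vval - 1) - a) := by abel
    rw [e]
    calc _ ≤ 2 * (16 * θ) ^ 2 + 586 * θ ^ 2 := (norm_sub_le _ _).trans (add_le_add h1 hVa)
      _ = 1098 * θ ^ 2 := by ring
  -- sizes of the first-order letters
  have hLin1 : ‖Lin‖ ≤ 24 * θ := by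
    have e : Lin = (Ubar - 1) - (Ubar - 1 - Lin) := by abel
    rw [e]
    calc _ ≤ 17 * θ + 660 * θ ^ 2 := (norm_sub_le _ _).trans (add_le_add hU1 hUlin)
      _ ≤ 24 * θ := by nlinarith
  have hna : ‖-a‖ ≤ θ := by rw [norm_neg]; exact ha1
  have hx1 : ‖(1 : 𝔸) + -a‖ ≤ 1 + θ := norm_add_le_of_le norm_one.le hna
  have hy1 : ‖(1 : 𝔸) + Lin‖ ≤ 1 + 24 * θ := norm_add_le_of_le norm_one.le hLin1
  have hUn : ‖Ubar‖ ≤ 1 + 17 * θ := by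
    calc ‖Ubar‖ = ‖(Ubar - 1) + 1‖ := by rw [sub_add_cancel]
      _ ≤ ‖Ubar - 1‖ + 1 := norm_add_le_of_le le_rfl norm_one.le
      _ ≤ 1 + 17 * θ := by linarith
  have hW'n : ‖eW'‖ ≤ 1 + 16 * θ := by
    calc ‖eW'‖ = ‖(eW' - 1) + 1‖ := by rw [sub_add_cancel]
      _ ≤ ‖eW' - 1‖ + 1 := norm_add_le_of_le le_rfl norm_one.le
      _ ≤ 1 + 16 * θ := by linarith
  have hUmodel : ‖Ubar - (1 + Lin)‖ ≤ 660 * θ ^ 2 := by rw [show Ubar - (1 + Lin) = Ubar - 1 - Lin by abel]; exact hUlin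
  have hW'model : ‖eW' - (1 + a')‖ ≤ 586 * θ ^ 2 := by rw [show eW' - (1 + a') = eW' - 1 - a' by abel]; exact hW'a
  -- the product to first order
  have hprod : ‖Vinv * Ubar * eW' - 1 - (-a + Lin + a')‖ ≤ 3200 * θ ^ 2 := by
    have hm := norm_triple_sub_models_le hVinv_a hUmodel hW'model hx1 hy1
    have hf := norm_three_factors_sub_lin_le (-a) Lin a'
    have e : Vinv * Ubar * eW' - 1 - (-a + Lin + a') =
        (Vinv * Ubar * eW' - (1 + -a) * (1 + Lin) * (1 + a')) + ((1 + -a) * (1 + Lin) * (1 + a') - 1 - (-a + Lin + a')) := by abel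
    rw [e]
    have hnum := log_step_numerics (nU := ‖Ubar‖) (nW := ‖eW'‖) (na := ‖-a‖) (nL := ‖Lin‖) (na' := ‖a'‖) hθ0 hθ
      (norm_nonneg _) (norm_nonneg _) (norm_nonneg _) hUn hW'n hna hLin1 ha'1
    exact (norm_add_le _ _).trans (by linarith [hm, hf, hnum])
  have hTB : ‖Vinv * Ubar * eW' - 1 - B‖ ≤ 3200 * θ ^ 2 := by
    rw [← hcancel, show Lin - a + a' = -a + Lin + a' by abel]; exact hprod
  -- the logarithm
  have hT12 : ‖Vinv * Ubar * eW' - 1‖ ≤ 1 / 2 := hT1.trans (by linarith)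
  have hlog : ‖mlog (Vinv * Ubar * eW') - (Vinv * Ubar * eW' - 1)‖ ≤ 4 * (39 * θ) ^ 2 := by
    refine (B7Prop1Explicit.norm_mlog_sub_le hT12).trans ?_
    refine (B7Prop1Explicit.expRem_le_sq (by positivity) (by linarith)).trans ?_
    have h0 : 0 ≤ ‖Vinv * Ubar * eW' - 1‖ := norm_nonneg _
    nlinarith
  have e : mlog (Vinv * Ubar * eW') - BX =
      (mlog (Vinv * Ubar * eW') - (Vinv * Ubar * eW' - 1)) + ((Vinv * Ubar * eW' - 1 - B) + (B - BX)) := by abel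
  rw [e]
  calc _ ≤ 4 * (39 * θ) ^ 2 + (3200 * θ ^ 2 + εB) := norm_add_le_of_le hlog (norm_add_le_of_le hTB hBBX)
    _ = 9284 * θ ^ 2 + εB := by ring

/-! ## §3 ★★ The double-bar one step in log coordinates -/

set_option maxHeartbeats 400000 in
/-- ★★ **THE DOUBLE-BAR ONE STEP IN LOG COORDINATES** ([Balaban1985Averaging] (121)–(125) for the double-bar average at the flat background, with the (0.4)
symmetrised staircase family and print's `exp[mean log]` frames (62)).  Let `S(b) = exp(X(b))` with `‖X(b)‖ ≤ r` on every bond with both ends in the two blocks of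
`c = ⟨y, y′⟩`, and `200·ℓ·r ≤ 1` (`ℓ = (d+2)L`).  Then the logarithm of the double-bar average is the MEAN OF THE STRAIGHT-SEGMENT SUMS up to second order:
`‖mlog(v(y)⁻¹·Ū(c)·v(y′)) − |I|⁻¹ Σ_{(n,σ,σ′)} X([x, x′])‖ ≤ 40000·ℓ²·r²` — the tube `L·(QX)(c)` of (125) is the WHOLE linear part (the staircase sums of `Ū`'s
linearisation are cancelled by the frames EXACTLY, `sum_idx_swap`), with a k-free one-step remainder constant `C♭₁ = 40000ℓ²` («LOG coordinates in, LOG coordinates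
out» — the letter the [Balaban1985Averaging] Prop. 5 kernel tower (148)–(155) consumes per level). [cite: Balaban1985Averaging, (62) p.28, (89) p.31, (121)-(125) p.36; Balaban1984PropagatorsI, (1.11) p.19] -/
theorem norm_mlog_dbar_sub_segMean_le (hj : j + 1 ≤ P.m + P.K) {S : GaugeField P j 𝔸ˣ} {X : PBond P j → 𝔸} (c : PBond P (j + 1)) {r : ℝ}
    (hr0 : 0 ≤ r) (hℓr : 200 * (((P.d + 2) * P.L : ℕ) : ℝ) * r ≤ 1)
    (hSX : ∀ b : PBond P j, (blockOf b.src = c.src ∨ blockOf b.src = c.tgt) → (blockOf b.tgt = c.src ∨ blockOf b.tgt = c.tgt) →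
      ((S b : 𝔸ˣ) : 𝔸) = exp (X b))
    (hX : ∀ b : PBond P j, (blockOf b.src = c.src ∨ blockOf b.src = c.tgt) → (blockOf b.tgt = c.src ∨ blockOf b.tgt = c.tgt) → ‖X b‖ ≤ r) :
    ‖mlog ((dbarAvgU S c : 𝔸ˣ) : 𝔸) -
        ((Fintype.card (Idx P) : ℂ))⁻¹ • ∑ i : Idx P,
          walkSum X (walk (walkEnd (emb c.src) (stairWord i.2.1 (off i.1))) (List.replicate P.L (c.dir, true)))‖ ≤
      40000 * (((P.d + 2) * P.L : ℕ) : ℝ) ^ 2 * r ^ 2 := by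
  rw [coe_dbarAvgU]
  have hℓ0 : 0 ≤ (((P.d + 2) * P.L : ℕ) : ℝ) := Nat.cast_nonneg _
  have hL1 : (1 : ℝ) ≤ P.L := by exact_mod_cast P.L_pos
  have hLℓ : (P.L : ℝ) ≤ (((P.d + 2) * P.L : ℕ) : ℝ) := by push_cast; nlinarith [show (0:ℝ) ≤ P.d from Nat.cast_nonneg _]
  -- the bond deviations: `s := 2r` bounds `‖S(b) − 1‖`, and `‖(S(b) − 1) − X(b)‖ ≤ r²`
  have hr1 : r ≤ 1 := by nlinarith
  have hs0 : (0 : ℝ) ≤ 2 * r := by positivity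
  have hℓs : 48 * (((P.d + 2) * P.L : ℕ) : ℝ) * (2 * r) ≤ 1 := by nlinarith
  have hθ0 : 0 ≤ (((P.d + 2) * P.L : ℕ) : ℝ) * (2 * r) := by positivity
  have hθ : (((P.d + 2) * P.L : ℕ) : ℝ) * (2 * r) ≤ 1 / 100 := by nlinarith
  have hSb : ∀ b : PBond P j, (blockOf b.src = c.src ∨ blockOf b.src = c.tgt) → (blockOf b.tgt = c.src ∨ blockOf b.tgt = c.tgt) →
      ‖((S b : 𝔸ˣ) : 𝔸) - 1‖ ≤ 2 * r ∧ ‖(((S b : 𝔸ˣ) : 𝔸) - 1) - X b‖ ≤ r ^ 2 := by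
    intro b h1 h2
    have hXb := hX b h1 h2
    have h := norm_exp_sub_one_sub_le_sq (hXb.trans hr1)
    rw [hSX b h1 h2]
    exact ⟨h.1.trans (by linarith), h.2.trans (pow_le_pow_left₀ (norm_nonneg _) hXb 2)⟩
  have hS : ∀ b : PBond P j, (blockOf b.src = c.src ∨ blockOf b.src = c.tgt) → (blockOf b.tgt = c.src ∨ blockOf b.tgt = c.tgt) →
      ‖((S b : 𝔸ˣ) : 𝔸) - 1‖ ≤ 2 * r := fun b h1 h2 => (hSb b h1 h2).1
  have hSsrc : ∀ b : PBond P j, blockOf b.src = c.src → blockOf b.tgt = c.src → ‖((S b : 𝔸ˣ) : 𝔸) - 1‖ ≤ 2 * r :=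
    fun b h1 h2 => hS b (Or.inl h1) (Or.inl h2)
  have hStgt : ∀ b : PBond P j, blockOf b.src = c.tgt → blockOf b.tgt = c.tgt → ‖((S b : 𝔸ˣ) : 𝔸) - 1‖ ≤ 2 * r :=
    fun b h1 h2 => hS b (Or.inr h1) (Or.inr h2)
  -- the letters from the engine and from §1
  obtain ⟨hUlin, hU1⟩ := norm_emlAvgU_sub_one_sub_lin_le hj c hs0 hℓs hS
  obtain ⟨hWa, hW1⟩ := norm_vframeU_sub_one_sub_combMean_le hj c.src hs0 hℓs hSsrc
  obtain ⟨hW'a, hW'1⟩ := norm_vframeU_sub_one_sub_combMean_le hj c.tgt hs0 hℓs hStgt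
  have ha1 := norm_combSum_mean_le_of_block hj c.src hs0 hSsrc
  have ha'1 := norm_combSum_mean_le_of_block hj c.tgt hs0 hStgt
  have hT1 := norm_dbarAvgU_sub_one_le hj c hs0 hℓs hS
  rw [coe_dbarAvgU] at hT1
  -- (0) the exact cancellation of the staircase sums: `Lin − a + a′ = B`
  have hcancel : ((Fintype.card (Idx P) : ℂ))⁻¹ • ∑ i : Idx P,
        (walkSum (fun b => ((S b : 𝔸ˣ) : 𝔸) - 1) (walk (emb c.src) (stairWord i.2.1 (off i.1))) +
          walkSum (fun b => ((S b : 𝔸ˣ) : 𝔸) - 1) (walk (walkEnd (emb c.src) (stairWord i.2.1 (off i.1))) (List.replicate P.L (c.dir, true))) -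
          walkSum (fun b => ((S b : 𝔸ˣ) : 𝔸) - 1) (walk (emb c.tgt) (stairWord i.2.2 (off i.1)))) -
      ((Fintype.card (Idx P) : ℂ))⁻¹ • ∑ i : Idx P, walkSum (fun b => ((S b : 𝔸ˣ) : 𝔸) - 1) (walk (emb c.src) (stairWord i.2.1 (off i.1))) +
      ((Fintype.card (Idx P) : ℂ))⁻¹ • ∑ i : Idx P, walkSum (fun b => ((S b : 𝔸ˣ) : 𝔸) - 1) (walk (emb c.tgt) (stairWord i.2.1 (off i.1))) =
      ((Fintype.card (Idx P) : ℂ))⁻¹ • ∑ i : Idx P,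
        walkSum (fun b => ((S b : 𝔸ˣ) : 𝔸) - 1) (walk (walkEnd (emb c.src) (stairWord i.2.1 (off i.1))) (List.replicate P.L (c.dir, true))) := by
    have hσ' : ∑ i : Idx P, walkSum (fun b => ((S b : 𝔸ˣ) : 𝔸) - 1) (walk (emb c.tgt) (stairWord i.2.2 (off i.1))) =
        ∑ i : Idx P, walkSum (fun b => ((S b : 𝔸ˣ) : 𝔸) - 1) (walk (emb c.tgt) (stairWord i.2.1 (off i.1))) :=
      sum_idx_swap fun r σ => walkSum (fun b => ((S b : 𝔸ˣ) : 𝔸) - 1) (walk (emb c.tgt) (stairWord σ (off r)))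
    rw [Finset.sum_sub_distrib, Finset.sum_add_distrib, hσ', smul_sub, smul_add]
    abel
  -- the segment sums of `S − 1` versus those of `X`
  have hBBX : ‖((Fintype.card (Idx P) : ℂ))⁻¹ • ∑ i : Idx P,
        walkSum (fun b => ((S b : 𝔸ˣ) : 𝔸) - 1) (walk (walkEnd (emb c.src) (stairWord i.2.1 (off i.1))) (List.replicate P.L (c.dir, true))) -
      ((Fintype.card (Idx P) : ℂ))⁻¹ • ∑ i : Idx P,
        walkSum X (walk (walkEnd (emb c.src) (stairWord i.2.1 (off i.1))) (List.replicate P.L (c.dir, true)))‖ ≤ (P.L : ℝ) * r ^ 2 := by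
    rw [← smul_sub, ← Finset.sum_sub_distrib]
    refine norm_card_inv_smul_sum_le (by positivity) fun i => ?_
    rw [← walkSum_sub']
    refine (norm_walkSum_le_of_steps (s := r ^ 2) _ _ fun st hst => ?_).trans (by rw [length_walk, List.length_replicate])
    have hmem : st ∈ walk (emb c.src) (loopWord P.L c.dir (off i.1) i.2.1 i.2.2) := by
      unfold loopWord; rw [walk_append, walk_append]; simp [hst]
    exact (hSb st.bond (two_block_of_mem_loopWalk hj c i hmem).1 (two_block_of_mem_loopWalk hj c i hmem).2).2
  -- assemble through the abstract bookkeeping at `θ := ℓ·(2r)`, `ε_B := L·r²` (`Vinv·Vval = 1` is `Units.inv_mul`)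
  have key := dbar_log_bookkeeping hθ0 hθ (vframeU S c.src).inv_mul
    (by rw [mul_pow, ← mul_assoc]; exact hWa) (by linarith [hW1]) (by rw [mul_pow, ← mul_assoc]; exact hUlin) (by linarith [hU1])
    (by rw [mul_pow, ← mul_assoc]; exact hW'a) (by linarith [hW'1]) ha1 ha'1 hcancel hBBX
    (by
      refine hT1.trans ?_
      have : 3800 * (((P.d + 2) * P.L : ℕ) : ℝ) ^ 2 * (2 * r) ^ 2 =
          3800 * (((((P.d + 2) * P.L : ℕ) : ℝ) * (2 * r)) * ((((P.d + 2) * P.L : ℕ) : ℝ) * (2 * r))) := by ring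
      rw [this]
      nlinarith [mul_le_mul_of_nonneg_right hLℓ hs0])
  refine key.trans ?_
  have hLr : (P.L : ℝ) * r ^ 2 ≤ (((P.d + 2) * P.L : ℕ) : ℝ) ^ 2 * r ^ 2 := by
    have : (P.L : ℝ) ≤ (((P.d + 2) * P.L : ℕ) : ℝ) ^ 2 := by nlinarith
    exact mul_le_mul_of_nonneg_right this (sq_nonneg r)
  nlinarith [sq_nonneg ((((P.d + 2) * P.L : ℕ) : ℝ) * r)]

end Summit.QuantumFields.YangMills.Theorems.Prop8ChartDoubleBar

end
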